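/-
Copyright (c) 2026 the pub-hodgecm-mathlib formalisation cell (harness21).  Prover seat hodgecm-mathlib-K2E1-p02 (g5), Track B ∕ K2-LIT,
h413 = `stmt-HodgeConjecture-24833`, line `K2_E1_TraceFormulaBeta`, «EIS-RANK-ONE» rung R6d₂ assembled: the UNIFORM BOUND `‖E(f)(g) − E(f)_B(g)‖ ≤ μ(D)⁻¹·C` for ALL
`g ∈ U(J₂)(𝔸_F)` with `H(g) > T` (the shape R6e consumes), from parts (a), (b), (b-i).  2026-09-04.
-/
import Summits.HodgeConjecture.HodgeConjecture.Theorems.K2E1BigCellLineDilationU2   -- ★ parts (a) p857537, (b) p857572, (b-i) p857599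
import HarnessLib

/-!
# h413 ∕ Track B «K2-LIT», «EIS-RANK-ONE» R6d₂ assembled — helper `K2E1EisensteinMinusConstantTermCuspBoundU2`:
# `∀ g, T < H(g) → ‖E(f)(g) − E(f)_B(g)‖ ≤ μ(D)⁻¹ · C` on `U(J₂)`, through the Iwasawa decomposition `g = n(x_u) · t · k`

Cell `pub/hodgecm-mathlib`, crux H413 = `stmt-HodgeConjecture-24833`, route `HCCMUnconditional`; DEAL «EIS-R6d₂» of the dealer K2E1-plan (g3) 2026-09-04T05:01:15Z ∕ «=»
05:04:18Z («export the all-`g` form `∀ g, T < H g → ‖…‖ ≤ M` that K2E4-p10 (g3)'s R6e consumes»).  THEOREMS ONLY (no `def`, no `instance`, no `notation`, no named-fact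
hypothesis, no `sorry`); lane `--kind proof --supports stmt-HodgeConjecture-24833 --as helper` (count-neutral).

ASSEMBLY.  For `g = n(x_u) · t · k` (`x_u ∈ 𝔸_F`, `t = diag(d₀, d₁) ∈ T(𝔸_F)`, `k` in a set `K` on which the Borel height is `≤ T`): `H(g) = ‖d₀‖_E · H(k)` (★
`borelHeight_unipotent_mul`, ★ `borelHeight_torus_mul'`), so `T < H(g)` forces `‖d₀‖_E > 1`, i.e. `|Λ|_F = ‖d₁‖_E = ‖d₀‖_E⁻¹ ≤ 1` for the line scalar `Λ` of ★ (b-i)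
`exists_lineScalar_two`; ★ (b-i) `bigCell_line_dilation_two` ∕ `norm_multiplier_eq_rpow` supply the structure hypotheses `hdil` ∕ `hm` of ★ (b)
`norm_sub_borelConstantTerm_le_const_two`, whose remaining inputs are, per `g`, the Poisson hypotheses of part (a) (`hΦc hΦi hloc`, the normalisation `hnorm`,
Godement's `hfin`, the summability `hs`) and, per `k ∈ K`, the FOURIER-SIDE DECAY BINDER at the ideles `Λ'` with `1 ≤ |Λ'|_F`:
`Summable (ξ ↦ ‖𝓕Φ_k(ξΛ')‖)` and `Σ_ξ 𝟙_{ξ≠0} ‖𝓕Φ_k(ξΛ')‖ ≤ C·|Λ'|^{−β}` (K2E4-p10 (g3)'s `K2E1AdelicFourierDecay` discharges it for `K`-finite flat sections).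
With `1 ≤ σ + β` (`σ = Re z`) the bound is `μ(D)⁻¹ · C`, uniform in `g`.

* §1 `ideleNorm_inv_coe` (`|Λ⁻¹| = |Λ|⁻¹` in `ℝ`), `borelHeight_chart_mul_torus_mul` (`H(n(x_u) t k) = ‖d₀‖_E · H(k)`).
* §2 **`norm_sub_borelConstantTerm_le_of_iwasawa_two`** — the bound at ONE `g = n(x_u) t k` with `H(k) ≤ T < H(g)`; **`forall_norm_sub_borelConstantTerm_le_two`** —
  `∀ g, T < H(g) → ‖E(f)(g) − E(f)_B(g)‖ ≤ μ(D)⁻¹ · C` under the Iwasawa hypothesis `hIw : ∀ g, ∃ x_u t, ∃ k ∈ K, g = n(x_u) t k` and `H ≤ T` on `K`.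

HONEST LABEL.  Count-neutral helper; proves no printed statement; HC_CM is proved only modulo the 7 printed citations (2 remaining named inputs: hLiu418 =
`stmt-HodgeConjecture-24832`, h413 = `stmt-HodgeConjecture-24833`) until rung 0 closes.

## References
* [Garrett2018] P. Garrett, *Modern Analysis of Automorphic Forms by Example*, vol. 1 (2018), §2.9 (`E − E_P` is of rapid decay on Siegel sets).
* [MoeglinWaldspurger1995] C. Mœglin, J.-L. Waldspurger, *Spectral decomposition and Eisenstein series* (1995), I.2.10–I.2.12, II.1.7.
-/

set_option autoImplicit false
set_option linter.dupNamespace false  -- the mandated namespace repeats the summit's segment (`HodgeConjecture.HodgeConjecture`)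

noncomputable section

open scoped Matrix NNReal
open MeasureTheory NumberField IsDedekindDomain MulAction
open Literature.NumberTheory.Automorphic Literature.NumberTheory.Automorphic.UnitaryGroup Literature.NumberTheory.GaloisRepresentations
open Summit.HodgeConjecture.HodgeConjecture.Cruxes.H413.K2E1BorelEisensteinU
open Summit.HodgeConjecture.HodgeConjecture.Cruxes.H413.K2E1EisensteinMinusConstantTermPoissonU2
open Summit.HodgeConjecture.HodgeConjecture.Cruxes.H413.K2E1EisensteinMinusConstantTermBoundU2
open Summit.HodgeConjecture.HodgeConjecture.Cruxes.H413.K2E1BigCellLineDilationU2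

namespace Summit.HodgeConjecture.HodgeConjecture.Cruxes.H413.K2E1EisensteinMinusConstantTermCuspBoundU2

variable {F E : Type} [Field F] [NumberField F] [Field E] [NumberField E] [Algebra F E] [Algebra.IsQuadraticExtension F E] {c : E ≃ₐ[F] E}
  (hij : (((0 : Fin 2) : ℕ)) + 1 = ((1 : Fin 2) : ℕ)) (hN : 2 = 2 * ((0 : Fin 2) : ℕ) + 2) {δ : E}

/-! ## §1 Bookkeeping: the norm of an inverse idele, the height along `n(x_u) t k` -/

omit [NumberField E] [Algebra F E] [Algebra.IsQuadraticExtension F E] in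
/-- `|Λ⁻¹|_F = |Λ|_F⁻¹` in `ℝ`. [folklore] -/
theorem ideleNorm_inv_coe (Λ : (AdeleRing (𝓞 F) F)ˣ) :
    ((IdeleClassGroup.ideleNorm F Λ⁻¹ : ℝ≥0) : ℝ) = ((IdeleClassGroup.ideleNorm F Λ : ℝ≥0) : ℝ)⁻¹ := by
  rw [map_inv, NNReal.coe_inv]

/-- **`H(n(x_u) · t · k) = ‖d₀‖_E · H(k)`** (★ `borelHeight_unipotent_mul`, ★ `borelHeight_torus_mul'`). [cite: Garrett2018, §2.2] -/
theorem borelHeight_chart_mul_torus_mul (hcδ : c δ = -δ) (hδ : δ ≠ 0) (xu : (AdeleRing (𝓞 F) F)) (t : ↥(torusInBorel F E c 2)) {d : Fin 2 → (AdeleRing (𝓞 E) E)ˣ}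
    (hd : glDiagonal 2 (AdeleRing (𝓞 E) E) d = adelicVal F E c 2 _ ((t : borelAdelic F E c 2) : (quasiSplit F E c 2).Adelic)) (k : (quasiSplit F E c 2).Adelic) :
    borelHeight (((middleRootUnipotent hij hN (Multiplicative.ofAdd (traceZeroLine F E c hcδ hδ xu)) : ↥(adelicUnipotent F E c 2)) : (quasiSplit F E c 2).Adelic) * ((t : borelAdelic F E c 2) : (quasiSplit F E c 2).Adelic) * k) = IdeleClassGroup.ideleNorm E (d 0) * borelHeight k := by
  rw [mul_assoc, borelHeight_unipotent_mul (middleRootUnipotent hij hN (Multiplicative.ofAdd (traceZeroLine F E c hcδ hδ xu))).2, borelHeight_torus_mul' hd]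

/-! ## §2 The uniform bound in the cusp -/

/-- **THE BOUND AT ONE `g = n(x_u) · t · k` WITH `H(k) ≤ T < H(g)`**: all of ★ (a) ∕ (b) ∕ (b-i) assembled — Poisson's hypotheses and `hnorm` at this `g`, the
binder at `k` for the idele `Λ⁻¹` (`|Λ⁻¹| ≥ 1`), the section law of exponent `z` with `χ` unitary, `1 ≤ Re z + β`:  `‖E(f)(g) − E(f)_B(g)‖ ≤ μ(D)⁻¹ · C`.
[cite: Garrett2018, §2.9] [cite: MoeglinWaldspurger1995, II.1.7] -/
theorem norm_sub_borelConstantTerm_le_of_iwasawa_two (hcδ : c δ = -δ) (hδ : δ ≠ 0)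
    [MeasurableSpace (quasiSplit F E c 2).Adelic] [BorelSpace (quasiSplit F E c 2).Adelic]
    (νN : Measure ↥(adelicUnipotent F E c 2)) [νN.IsMulLeftInvariant] [νN.IsInvInvariant]
    (χ : HeckeCharacter E) (hχ : χ.IsUnitary) (z : ℂ) {f : (quasiSplit F E c 2).Adelic → ℂ} (hfm : Measurable f)
    (hfN : ∀ (n : ↥(adelicUnipotent F E c 2)) (y : (quasiSplit F E c 2).Adelic), f ((n : (quasiSplit F E c 2).Adelic) * y) = f y)
    (hfB : ∀ b ∈ borelU (c : E →+* E) ((StdForm.antidiagonal 2).over E), ∀ x : (quasiSplit F E c 2).Adelic, f ((quasiSplit F E c 2).toAdelic b * x) = f x)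
    (hf : ∀ (b g : (quasiSplit F E c 2).Adelic) (u : (AdeleRing (𝓞 E) E)ˣ),
      ((b.1 : GL (Fin 2) (AdeleRing (𝓞 E) E)) : Matrix (Fin 2) (Fin 2) (AdeleRing (𝓞 E) E)) 1 0 = 0 →
      (u : (AdeleRing (𝓞 E) E)) = ((b.1 : GL (Fin 2) (AdeleRing (𝓞 E) E)) : Matrix (Fin 2) (Fin 2) (AdeleRing (𝓞 E) E)) 0 0 →
        f (b * g) = ((χ u : ℂˣ) : ℂ) * ((ideleNorm u : ℝ) : ℂ) ^ z * f g)
    {𝓕 : Set ↥(adelicUnipotent F E c 2)} (h𝓕 : IsFundamentalDomain ↥(rationalUnipotent F E c 2) 𝓕 νN) (h𝓕₀ : νN 𝓕 ≠ 0) (h𝓕top : νN 𝓕 ≠ ⊤)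
    [MeasurableSpace (AdeleRing (𝓞 F) F)] [BorelSpace (AdeleRing (𝓞 F) F)] (μ : Measure (AdeleRing (𝓞 F) F)) [μ.IsAddHaarMeasure]
    {C β T : ℝ} (hC : 0 ≤ C) (hσβ : 1 ≤ z.re + β)
    -- the data of `g = n(x_u) t k`
    (xu : (AdeleRing (𝓞 F) F)) (t : ↥(torusInBorel F E c 2)) (k : (quasiSplit F E c 2).Adelic) (hk : (borelHeight k : ℝ) ≤ T)
    (hT : T < (borelHeight (((middleRootUnipotent hij hN (Multiplicative.ofAdd (traceZeroLine F E c hcδ hδ xu)) : ↥(adelicUnipotent F E c 2)) : (quasiSplit F E c 2).Adelic) * ((t : borelAdelic F E c 2) : (quasiSplit F E c 2).Adelic) * k) : ℝ))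
    -- Godement ∕ summability ∕ Poisson ∕ normalisation at this `g`
    (hfin : ∫⁻ u in 𝓕, (∑' q : (quasiSplit F E c 2).quotientSubgroup ⧸ (borelAdelic F E c 2).subgroupOf (quasiSplit F E c 2).quotientSubgroup,
        ‖f ((((q.out : (quasiSplit F E c 2).quotientSubgroup) : (quasiSplit F E c 2).Adelic))⁻¹ * (u : (quasiSplit F E c 2).Adelic) *
          (((middleRootUnipotent hij hN (Multiplicative.ofAdd (traceZeroLine F E c hcδ hδ xu)) : ↥(adelicUnipotent F E c 2)) : (quasiSplit F E c 2).Adelic) * ((t : borelAdelic F E c 2) : (quasiSplit F E c 2).Adelic) * k))‖ₑ) ∂νN < ⊤)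
    (hs : Summable fun q : Quotient (orbitRel ↥(borelU (c : E →+* E) ((StdForm.antidiagonal 2).over E)) ↥(unitaryGroupOfForm (c : E →+* E) ((StdForm.antidiagonal 2).over E))) =>
      f ((quasiSplit F E c 2).toAdelic (Quotient.out q : ↥(unitaryGroupOfForm (c : E →+* E) ((StdForm.antidiagonal 2).over E))) * (((middleRootUnipotent hij hN (Multiplicative.ofAdd (traceZeroLine F E c hcδ hδ xu)) : ↥(adelicUnipotent F E c 2)) : (quasiSplit F E c 2).Adelic) * ((t : borelAdelic F E c 2) : (quasiSplit F E c 2).Adelic) * k)))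
    (hΦc : Continuous (fun x : (AdeleRing (𝓞 F) F) => f (((quasiSplit F E c 2).toAdelic (weylLongU (c : E →+* E) (rfl : ((StdForm.antidiagonal 2).over E) = ((StdForm.antidiagonal 2).over E)))) * ((middleRootUnipotent hij hN (Multiplicative.ofAdd (traceZeroLine F E c hcδ hδ x)) : ↥(adelicUnipotent F E c 2)) : (quasiSplit F E c 2).Adelic) * (((middleRootUnipotent hij hN (Multiplicative.ofAdd (traceZeroLine F E c hcδ hδ xu)) : ↥(adelicUnipotent F E c 2)) : (quasiSplit F E c 2).Adelic) * ((t : borelAdelic F E c 2) : (quasiSplit F E c 2).Adelic) * k))))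
    (hΦi : Integrable (fun x : (AdeleRing (𝓞 F) F) => f (((quasiSplit F E c 2).toAdelic (weylLongU (c : E →+* E) (rfl : ((StdForm.antidiagonal 2).over E) = ((StdForm.antidiagonal 2).over E)))) * ((middleRootUnipotent hij hN (Multiplicative.ofAdd (traceZeroLine F E c hcδ hδ x)) : ↥(adelicUnipotent F E c 2)) : (quasiSplit F E c 2).Adelic) * (((middleRootUnipotent hij hN (Multiplicative.ofAdd (traceZeroLine F E c hcδ hδ xu)) : ↥(adelicUnipotent F E c 2)) : (quasiSplit F E c 2).Adelic) * ((t : borelAdelic F E c 2) : (quasiSplit F E c 2).Adelic) * k))) μ)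
    (hloc : ∀ C₀ : Set (AdeleRing (𝓞 F) F), IsCompact C₀ → ∃ u : F → ℝ, Summable u ∧
      ∀ x ∈ C₀, ∀ ξ : F, ‖(fun x : (AdeleRing (𝓞 F) F) => f (((quasiSplit F E c 2).toAdelic (weylLongU (c : E →+* E) (rfl : ((StdForm.antidiagonal 2).over E) = ((StdForm.antidiagonal 2).over E)))) * ((middleRootUnipotent hij hN (Multiplicative.ofAdd (traceZeroLine F E c hcδ hδ x)) : ↥(adelicUnipotent F E c 2)) : (quasiSplit F E c 2).Adelic) * (((middleRootUnipotent hij hN (Multiplicative.ofAdd (traceZeroLine F E c hcδ hδ xu)) : ↥(adelicUnipotent F E c 2)) : (quasiSplit F E c 2).Adelic) * ((t : borelAdelic F E c 2) : (quasiSplit F E c 2).Adelic) * k))) (x + algebraMap F (AdeleRing (𝓞 F) F) ξ)‖ ≤ u ξ)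
    (hnorm : ((νN 𝓕).toReal⁻¹ : ℝ) • ∫ v : ↥(adelicUnipotent F E c 2), f (((quasiSplit F E c 2).toAdelic (weylLongU (c : E →+* E) (rfl : ((StdForm.antidiagonal 2).over E) = ((StdForm.antidiagonal 2).over E)))) * (v : (quasiSplit F E c 2).Adelic) *
        (((middleRootUnipotent hij hN (Multiplicative.ofAdd (traceZeroLine F E c hcδ hδ xu)) : ↥(adelicUnipotent F E c 2)) : (quasiSplit F E c 2).Adelic) * ((t : borelAdelic F E c 2) : (quasiSplit F E c 2).Adelic) * k)) ∂νN =
      ((μ (adeleFundamentalDomain F)).toReal⁻¹ : ℂ) * ∫ x, (fun x : (AdeleRing (𝓞 F) F) => f (((quasiSplit F E c 2).toAdelic (weylLongU (c : E →+* E) (rfl : ((StdForm.antidiagonal 2).over E) = ((StdForm.antidiagonal 2).over E)))) * ((middleRootUnipotent hij hN (Multiplicative.ofAdd (traceZeroLine F E c hcδ hδ x)) : ↥(adelicUnipotent F E c 2)) : (quasiSplit F E c 2).Adelic) * (((middleRootUnipotent hij hN (Multiplicative.ofAdd (traceZeroLine F E c hcδ hδ xu)) : ↥(adelicUnipotent F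 E c 2)) : (quasiSplit F E c 2).Adelic) * ((t : borelAdelic F E c 2) : (quasiSplit F E c 2).Adelic) * k))) x ∂μ)
    -- the Fourier-side decay binder at `k`
    (hdec : ∀ Λ' : (AdeleRing (𝓞 F) F)ˣ, 1 ≤ ((IdeleClassGroup.ideleNorm F Λ' : ℝ≥0) : ℝ) →
      (Summable fun ξ : F => ‖∫ v, (fun x : (AdeleRing (𝓞 F) F) => f (((quasiSplit F E c 2).toAdelic (weylLongU (c : E →+* E) (rfl : ((StdForm.antidiagonal 2).over E) = ((StdForm.antidiagonal 2).over E)))) * ((middleRootUnipotent hij hN (Multiplicative.ofAdd (traceZeroLine F E c hcδ hδ x)) : ↥(adelicUnipotent F E c 2)) : (quasiSplit F E c 2).Adelic) * k)) v * (adeleAddChar F (algebraMap F (AdeleRing (𝓞 F) F) ξ * (Λ' : (AdeleRing (𝓞 F) F)) * v) : ℂ) ∂μ‖) ∧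
      ∑' ξ : F, ({0}ᶜ : Set F).indicator (fun ξ => ‖∫ v, (fun x : (AdeleRing (𝓞 F) F) => f (((quasiSplit F E c 2).toAdelic (weylLongU (c : E →+* E) (rfl : ((StdForm.antidiagonal 2).over E) = ((StdForm.antidiagonal 2).over E)))) * ((middleRootUnipotent hij hN (Multiplicative.ofAdd (traceZeroLine F E c hcδ hδ x)) : ↥(adelicUnipotent F E c 2)) : (quasiSplit F E c 2).Adelic) * k)) v * (adeleAddChar F (algebraMap F (AdeleRing (𝓞 F) F) ξ * (Λ' : (AdeleRing (𝓞 F) F)) * v) : ℂ) ∂μ‖) ξ ≤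
        C * ((IdeleClassGroup.ideleNorm F Λ' : ℝ≥0) : ℝ) ^ (-β)) :
    ‖eisensteinSeriesU f (((middleRootUnipotent hij hN (Multiplicative.ofAdd (traceZeroLine F E c hcδ hδ xu)) : ↥(adelicUnipotent F E c 2)) : (quasiSplit F E c 2).Adelic) * ((t : borelAdelic F E c 2) : (quasiSplit F E c 2).Adelic) * k) -
        borelConstantTerm νN 𝓕 (eisensteinSeriesU f) (((middleRootUnipotent hij hN (Multiplicative.ofAdd (traceZeroLine F E c hcδ hδ xu)) : ↥(adelicUnipotent F E c 2)) : (quasiSplit F E c 2).Adelic) * ((t : borelAdelic F E c 2) : (quasiSplit F E c 2).Adelic) * k)‖ ≤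
      (μ (adeleFundamentalDomain F)).toReal⁻¹ * C := by
  -- the diagonal presentation of `t`, the line scalar `Λ`, `|Λ| = ‖d₁‖ = ‖d₀‖⁻¹ ≤ 1`
  have ht : torusPart (t : borelAdelic F E c 2) = t := (mem_torusInBorel_iff_torusPart_eq _).1 t.2
  have hd : glDiagonal 2 (AdeleRing (𝓞 E) E) (diagUnit (t : borelAdelic F E c 2).2) = adelicVal F E c 2 _ ((t : borelAdelic F E c 2) : (quasiSplit F E c 2).Adelic) := by
    rw [← adelicVal_torusPart, ht]
  obtain ⟨Λ, hΛ⟩ := exists_lineScalar_two hcδ hδ t hd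
  have hHk : 0 < (borelHeight k : ℝ) := by
    rw [borelHeight_def]
    exact_mod_cast inv_pos.2 (vecHeight_lastRow_pos k)
  have hd0 : 1 < ((IdeleClassGroup.ideleNorm E (diagUnit (t : borelAdelic F E c 2).2 0) : ℝ≥0) : ℝ) := by
    rw [borelHeight_chart_mul_torus_mul hij hN hcδ hδ xu t hd k, NNReal.coe_mul] at hT
    by_contra hle
    have hle' : ((IdeleClassGroup.ideleNorm E (diagUnit (t : borelAdelic F E c 2).2 0) : ℝ≥0) : ℝ) ≤ 1 := not_lt.1 hle
    have : ((IdeleClassGroup.ideleNorm E (diagUnit (t : borelAdelic F E c 2).2 0) : ℝ≥0) : ℝ) * (borelHeight k : ℝ) ≤ 1 * T :=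
      mul_le_mul hle' hk hHk.le zero_le_one
    linarith
  have hΛnorm : ((IdeleClassGroup.ideleNorm F Λ : ℝ≥0) : ℝ) = ((IdeleClassGroup.ideleNorm E (diagUnit (t : borelAdelic F E c 2).2 0) : ℝ≥0) : ℝ)⁻¹ := by
    rw [ideleNorm_lineScalar_eq t hd Λ hΛ, ideleNorm_torus_one_eq_inv t hd, NNReal.coe_inv]
  have hΛle : ((IdeleClassGroup.ideleNorm F Λ : ℝ≥0) : ℝ) ≤ 1 := by
    rw [hΛnorm]
    exact inv_le_one_of_one_le₀ hd0.le
  have hΛpos : 0 < ((IdeleClassGroup.ideleNorm F Λ : ℝ≥0) : ℝ) := by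
    rw [hΛnorm]; exact inv_pos.2 (lt_trans zero_lt_one hd0)
  have hΛinv : 1 ≤ ((IdeleClassGroup.ideleNorm F Λ⁻¹ : ℝ≥0) : ℝ) := by
    rw [ideleNorm_inv_coe]
    exact one_le_inv_iff₀.2 ⟨hΛpos, hΛle⟩
  obtain ⟨hsumk, hdeck⟩ := hdec Λ⁻¹ hΛinv
  rw [ideleNorm_inv_coe] at hdeck
  exact norm_sub_borelConstantTerm_le_const_two hij hN hcδ hδ νN hfm hfN hfB h𝓕 h𝓕₀ h𝓕top _ hfin hs μ (fun _ => rfl) hΦc hΦi hloc hnorm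
    (Φk := fun y : (AdeleRing (𝓞 F) F) => f (((quasiSplit F E c 2).toAdelic (weylLongU (c : E →+* E) (rfl : ((StdForm.antidiagonal 2).over E) = ((StdForm.antidiagonal 2).over E)))) * ((middleRootUnipotent hij hN (Multiplicative.ofAdd (traceZeroLine F E c hcδ hδ y)) : ↥(adelicUnipotent F E c 2)) : (quasiSplit F E c 2).Adelic) * k))
    (((χ (diagUnit (t : borelAdelic F E c 2).2 1) : ℂˣ) : ℂ) * ((ideleNorm (diagUnit (t : borelAdelic F E c 2).2 1) : ℝ) : ℂ) ^ z) Λ (-xu)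
    (bigCell_line_dilation_two hij hN hcδ hδ χ z hf t hd Λ hΛ xu k) hsumk hC hdeck (norm_multiplier_eq_rpow χ hχ z t hd Λ hΛ) hΛle hσβ


/-- **R6d₂ ASSEMBLED — THE UNIFORM BOUND IN THE CUSP (the shape R6e consumes):** under the Iwasawa decomposition `G(𝔸) = N(𝔸) · T(𝔸) · K` with `H ≤ T` on `K` (`hIw`, `hK`),
the per-`g` Poisson ∕ Godement ∕ normalisation hypotheses of part (a), the Fourier-side decay binder on `K` (part (c), K2E4-p10 (g3)'s `K2E1AdelicFourierDecay`), the section law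
of exponent `z` with `χ` unitary and `1 ≤ Re z + β`:  `∀ g, T < H(g) → ‖E(f)(g) − E(f)_B(g)‖ ≤ μ(D)⁻¹ · C`. [cite: Garrett2018, §2.9] [cite: MoeglinWaldspurger1995, I.2.12] -/
theorem forall_norm_sub_borelConstantTerm_le_two (hcδ : c δ = -δ) (hδ : δ ≠ 0)
    [MeasurableSpace (quasiSplit F E c 2).Adelic] [BorelSpace (quasiSplit F E c 2).Adelic]
    (νN : Measure ↥(adelicUnipotent F E c 2)) [νN.IsMulLeftInvariant] [νN.IsInvInvariant]
    (χ : HeckeCharacter E) (hχ : χ.IsUnitary) (z : ℂ) {f : (quasiSplit F E c 2).Adelic → ℂ} (hfm : Measurable f)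
    (hfN : ∀ (n : ↥(adelicUnipotent F E c 2)) (y : (quasiSplit F E c 2).Adelic), f ((n : (quasiSplit F E c 2).Adelic) * y) = f y)
    (hfB : ∀ b ∈ borelU (c : E →+* E) ((StdForm.antidiagonal 2).over E), ∀ x : (quasiSplit F E c 2).Adelic, f ((quasiSplit F E c 2).toAdelic b * x) = f x)
    (hf : ∀ (b g : (quasiSplit F E c 2).Adelic) (u : (AdeleRing (𝓞 E) E)ˣ),
      ((b.1 : GL (Fin 2) (AdeleRing (𝓞 E) E)) : Matrix (Fin 2) (Fin 2) (AdeleRing (𝓞 E) E)) 1 0 = 0 →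
      (u : (AdeleRing (𝓞 E) E)) = ((b.1 : GL (Fin 2) (AdeleRing (𝓞 E) E)) : Matrix (Fin 2) (Fin 2) (AdeleRing (𝓞 E) E)) 0 0 →
        f (b * g) = ((χ u : ℂˣ) : ℂ) * ((ideleNorm u : ℝ) : ℂ) ^ z * f g)
    {𝓕 : Set ↥(adelicUnipotent F E c 2)} (h𝓕 : IsFundamentalDomain ↥(rationalUnipotent F E c 2) 𝓕 νN) (h𝓕₀ : νN 𝓕 ≠ 0) (h𝓕top : νN 𝓕 ≠ ⊤)
    [MeasurableSpace (AdeleRing (𝓞 F) F)] [BorelSpace (AdeleRing (𝓞 F) F)] (μ : Measure (AdeleRing (𝓞 F) F)) [μ.IsAddHaarMeasure]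
    {C β T : ℝ} (hC : 0 ≤ C) (hσβ : 1 ≤ z.re + β)
    -- Iwasawa decomposition through a set `K` on which the height is at most `T`
    {K : Set (quasiSplit F E c 2).Adelic} (hK : ∀ k ∈ K, (borelHeight k : ℝ) ≤ T)
    (hIw : ∀ g : (quasiSplit F E c 2).Adelic, ∃ (xu : (AdeleRing (𝓞 F) F)) (t : ↥(torusInBorel F E c 2)), ∃ k ∈ K,
      g = ((middleRootUnipotent hij hN (Multiplicative.ofAdd (traceZeroLine F E c hcδ hδ xu)) : ↥(adelicUnipotent F E c 2)) : (quasiSplit F E c 2).Adelic) * ((t : borelAdelic F E c 2) : (quasiSplit F E c 2).Adelic) * k)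
    -- Godement ∕ summability ∕ Poisson ∕ normalisation at every `g`
    (hfin : ∀ g : (quasiSplit F E c 2).Adelic, ∫⁻ u in 𝓕, (∑' q : (quasiSplit F E c 2).quotientSubgroup ⧸ (borelAdelic F E c 2).subgroupOf (quasiSplit F E c 2).quotientSubgroup,
        ‖f ((((q.out : (quasiSplit F E c 2).quotientSubgroup) : (quasiSplit F E c 2).Adelic))⁻¹ * (u : (quasiSplit F E c 2).Adelic) * g)‖ₑ) ∂νN < ⊤)
    (hs : ∀ g : (quasiSplit F E c 2).Adelic, Summable fun q : Quotient (orbitRel ↥(borelU (c : E →+* E) ((StdForm.antidiagonal 2).over E)) ↥(unitaryGroupOfForm (c : E →+* E) ((StdForm.antidiagonal 2).over E))) =>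
      f ((quasiSplit F E c 2).toAdelic (Quotient.out q : ↥(unitaryGroupOfForm (c : E →+* E) ((StdForm.antidiagonal 2).over E))) * g))
    (hΦc : ∀ g : (quasiSplit F E c 2).Adelic, Continuous (fun x : (AdeleRing (𝓞 F) F) => f (((quasiSplit F E c 2).toAdelic (weylLongU (c : E →+* E) (rfl : ((StdForm.antidiagonal 2).over E) = ((StdForm.antidiagonal 2).over E)))) * ((middleRootUnipotent hij hN (Multiplicative.ofAdd (traceZeroLine F E c hcδ hδ x)) : ↥(adelicUnipotent F E c 2)) : (quasiSplit F E c 2).Adelic) * g))) (hΦi : ∀ g : (quasiSplit F E c 2).Adelic, Integrable (fun x : (AdeleRing (𝓞 F) F) => f (((quasiSplit F E c 2).toAdelic (weylLongU (c : E →+* E) (rfl : ((StdForm.antidiagonal 2).over E) = ((StdForm.antidiagonal 2).over E)))) * ((middleRootUnipotent hij hN (Multiplicative.ofAdd (traceZeroLine F E c hcδ hδ x)) : ↥(adelicUnipotent F E c 2)) : (quasiSplit F E c 2).Adelic) * g)) μ)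
    (hloc : ∀ g : (quasiSplit F E c 2).Adelic, ∀ C₀ : Set (AdeleRing (𝓞 F) F), IsCompact C₀ → ∃ u : F → ℝ, Summable u ∧
      ∀ x ∈ C₀, ∀ ξ : F, ‖(fun x : (AdeleRing (𝓞 F) F) => f (((quasiSplit F E c 2).toAdelic (weylLongU (c : E →+* E) (rfl : ((StdForm.antidiagonal 2).over E) = ((StdForm.antidiagonal 2).over E)))) * ((middleRootUnipotent hij hN (Multiplicative.ofAdd (traceZeroLine F E c hcδ hδ x)) : ↥(adelicUnipotent F E c 2)) : (quasiSplit F E c 2).Adelic) * g)) (x + algebraMap F (AdeleRing (𝓞 F) F) ξ)‖ ≤ u ξ)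
    (hnorm : ∀ g : (quasiSplit F E c 2).Adelic, ((νN 𝓕).toReal⁻¹ : ℝ) • ∫ v : ↥(adelicUnipotent F E c 2), f (((quasiSplit F E c 2).toAdelic (weylLongU (c : E →+* E) (rfl : ((StdForm.antidiagonal 2).over E) = ((StdForm.antidiagonal 2).over E)))) * (v : (quasiSplit F E c 2).Adelic) * g) ∂νN =
      ((μ (adeleFundamentalDomain F)).toReal⁻¹ : ℂ) * ∫ x, (fun x : (AdeleRing (𝓞 F) F) => f (((quasiSplit F E c 2).toAdelic (weylLongU (c : E →+* E) (rfl : ((StdForm.antidiagonal 2).over E) = ((StdForm.antidiagonal 2).over E)))) * ((middleRootUnipotent hij hN (Multiplicative.ofAdd (traceZeroLine F E c hcδ hδ x)) : ↥(adelicUnipotent F E c 2)) : (quasiSplit F E c 2).Adelic) * g)) x ∂μ)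
    -- the Fourier-side decay binder on `K`
    (hdec : ∀ k ∈ K, ∀ Λ' : (AdeleRing (𝓞 F) F)ˣ, 1 ≤ ((IdeleClassGroup.ideleNorm F Λ' : ℝ≥0) : ℝ) →
      (Summable fun ξ : F => ‖∫ v, (fun x : (AdeleRing (𝓞 F) F) => f (((quasiSplit F E c 2).toAdelic (weylLongU (c : E →+* E) (rfl : ((StdForm.antidiagonal 2).over E) = ((StdForm.antidiagonal 2).over E)))) * ((middleRootUnipotent hij hN (Multiplicative.ofAdd (traceZeroLine F E c hcδ hδ x)) : ↥(adelicUnipotent F E c 2)) : (quasiSplit F E c 2).Adelic) * k)) v * (adeleAddChar F (algebraMap F (AdeleRing (𝓞 F) F) ξ * (Λ' : (AdeleRing (𝓞 F) F)) * v) : ℂ) ∂μ‖) ∧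
      ∑' ξ : F, ({0}ᶜ : Set F).indicator (fun ξ => ‖∫ v, (fun x : (AdeleRing (𝓞 F) F) => f (((quasiSplit F E c 2).toAdelic (weylLongU (c : E →+* E) (rfl : ((StdForm.antidiagonal 2).over E) = ((StdForm.antidiagonal 2).over E)))) * ((middleRootUnipotent hij hN (Multiplicative.ofAdd (traceZeroLine F E c hcδ hδ x)) : ↥(adelicUnipotent F E c 2)) : (quasiSplit F E c 2).Adelic) * k)) v * (adeleAddChar F (algebraMap F (AdeleRing (𝓞 F) F) ξ * (Λ' : (AdeleRing (𝓞 F) F)) * v) : ℂ) ∂μ‖) ξ ≤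
        C * ((IdeleClassGroup.ideleNorm F Λ' : ℝ≥0) : ℝ) ^ (-β)) :
    ∀ g : (quasiSplit F E c 2).Adelic, T < (borelHeight g : ℝ) →
      ‖eisensteinSeriesU f g - borelConstantTerm νN 𝓕 (eisensteinSeriesU f) g‖ ≤ (μ (adeleFundamentalDomain F)).toReal⁻¹ * C := by
  intro g hg
  obtain ⟨xu, t, k, hkK, rfl⟩ := hIw g
  exact norm_sub_borelConstantTerm_le_of_iwasawa_two hij hN hcδ hδ νN χ hχ z hfm hfN hfB hf h𝓕 h𝓕₀ h𝓕top μ hC hσβ xu t k (hK k hkK) hg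
    (hfin _) (hs _) (hΦc _) (hΦi _) (hloc _) (hnorm _) (hdec k hkK)

end Summit.HodgeConjecture.HodgeConjecture.Cruxes.H413.K2E1EisensteinMinusConstantTermCuspBoundU2

end
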